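import Literature.NumberTheory.Automorphic.UnitaryGroupHeisenbergConjThreeFactor
import Literature.NumberTheory.Automorphic.UnitaryGroupOfFormAdelicTopology
import HarnessLib

/-!
# The archimedean contraction of the three-factor parameters: `‖a₁‖, ‖a₂‖, ‖a₃‖ ≤ C · ρ(d)` on a Siegel set
(Rogawski, *Automorphic Representations of Unitary Groups in Three Variables* (1990), §2.2 (p. 13); Arthur (1978), §7)

Topic `NumberTheory/Automorphic`; namespace `Literature.NumberTheory.Automorphic.UnitaryGroup`.  THEOREMS ONLY (kernel lane): no `def`,
no named fact, no instance, no notation, no `sorry`.  Row H5b (FILE 2B, the BOUND of the three-factor normal form) of the T1-qs sub-line of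
`F0_T1InnerFormTraceIdentity` (cell hodgecm-mathlib, F0P3a RULING #100 (a)).

In ★ `adelicVal_borel_mul_conj_eq_threeFactor` (FILE 2A) the archimedean factor of `π((bk)⁻¹ u (bk))` is
`expGL(a₁ • Ad(κ⁻¹)E₀₂) · expGL(a₂ • Ad(κ⁻¹)E₀₁) · expGL(a₃ • Ad(κ⁻¹)E₁₂)` with `a₁ = (y′ + ½ x′c(x′))_∞`, `a₂ = x′_∞`, `a₃ = (−c(x′))_∞`, where
`x′ = d₀⁻¹d₁ · x`, `y′ = d₀⁻¹d₂ · y + (x₀ c(d₀⁻¹d₁ x) − d₀⁻¹d₁ x c(x₀))` are the coordinates of `b⁻¹ub` (★ `coordX_borel_conj`, ★ `coe_coordY_borel_conj`;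
`d = diagUnit b`, `x₀ = x(n₀)`, `n₀ = (torusPart b)⁻¹ b`).  With the torus relations (`c(d₀⁻¹d₁) = d₁⁻¹d₂`, `d₀⁻¹d₁ · d₁⁻¹d₂ = d₀⁻¹d₂`):
`y′ + ½ x′c(x′) = d₀⁻¹d₂ · (y + ½ x c(x)) + d₁⁻¹d₂ · x₀ c(x) − d₀⁻¹d₁ · x c(x₀)` (`archParam_identity`), so for `u` in a compact `K_N` and `n₀` in a compact `Ω`
all three parameters are `≤ C · ρ(d)` in norm, **`ρ(d) := max (max ‖(d₀⁻¹d₁)_∞‖ ‖(d₀⁻¹d₂)_∞‖) ‖(d₁⁻¹d₂)_∞‖`** (`(·)_∞ = archHom E`, sup norm of `mixedSpace E`),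
with `C = C(K_N, Ω)` (**`exists_forall_norm_archParam_le`**).  On the Siegel torus `d = (a, b′, c(a)⁻¹)` the three letters are `≍ |a|⁻¹, |a|⁻², |a|⁻¹`.

## References
* J. D. Rogawski, *Automorphic Representations of Unitary Groups in Three Variables*, Ann. of Math. Stud. 123 (1990), §2.2 [Rogawski1990].
* J. Arthur, *A trace formula for reductive groups I*, Duke Math. J. 45 (1978), §7 [Arthur1978TraceFormulaI].
-/

set_option autoImplicit false

noncomputable section

open Matrix NumberField NumberField.mixedEmbedding IsDedekindDomain Topology
-- `open scoped Classical` is needed to see the Mathlib normed-ring instances on `mixedSpace E` (note H5 of `AdelicGLnGlue`)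
open scoped MatrixGroups Classical

namespace Literature.NumberTheory.Automorphic

namespace UnitaryGroup

variable {F E : Type} [Field F] [NumberField F] [Field E] [NumberField E] [Algebra F E]
  {c : E ≃ₐ[F] E}

/-! ## §1 Torus relations for the diagonal of `b ∈ B(𝔸_F)` -/

/-- **`c(d₀⁻¹d₁) = d₁⁻¹d₂` and `d₀⁻¹d₁ · d₁⁻¹d₂ = d₀⁻¹d₂`** for the diagonal `d = diagUnit b` of `b ∈ B(𝔸_F)` (★ `torus_relations` for `torusPart b`:
`c(d₀) d₂ = 1`, `c(d₁) d₁ = 1`). [cite: Rogawski1990, §1.10] -/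
theorem conjAdele_rootOne_eq (b : borelAdelic F E c 3) :
    conjAdele F E c ((((diagUnit b.2 0)⁻¹ * diagUnit b.2 1 : (AdeleRing (𝓞 E) E)ˣ)) : AdeleRing (𝓞 E) E) =
        ((((diagUnit b.2 1)⁻¹ * diagUnit b.2 2 : (AdeleRing (𝓞 E) E)ˣ)) : AdeleRing (𝓞 E) E) ∧
      ((((diagUnit b.2 0)⁻¹ * diagUnit b.2 1 : (AdeleRing (𝓞 E) E)ˣ)) : AdeleRing (𝓞 E) E) *
          ((((diagUnit b.2 1)⁻¹ * diagUnit b.2 2 : (AdeleRing (𝓞 E) E)ˣ)) : AdeleRing (𝓞 E) E) =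
        ((((diagUnit b.2 0)⁻¹ * diagUnit b.2 2 : (AdeleRing (𝓞 E) E)ˣ)) : AdeleRing (𝓞 E) E) := by
  set t : torusInBorel F E c 3 := ⟨torusPart b, (mem_torusInBorel_iff _).2 (torusPart_mem_torusAdelic b)⟩ with ht
  have hd : glDiagonal 3 (AdeleRing (𝓞 E) E) (diagUnit b.2) =
      adelicVal F E c 3 _ (((t : torusInBorel F E c 3) : borelAdelic F E c 3) : (quasiSplit F E c 3).Adelic) := (adelicVal_torusPart b).symm
  obtain ⟨-, h11, h02⟩ := torus_relations t hd
  set d := diagUnit b.2 with hdd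
  have hc1 : conjAdele F E c (d 1 : AdeleRing (𝓞 E) E) = ((d 1)⁻¹ : (AdeleRing (𝓞 E) E)ˣ) :=
    (Units.inv_eq_of_mul_eq_one_left h11).symm
  have hc0 : conjAdele F E c (((d 0)⁻¹ : (AdeleRing (𝓞 E) E)ˣ) : AdeleRing (𝓞 E) E) = d 2 := by
    have h1 : conjAdele F E c (((d 0)⁻¹ : (AdeleRing (𝓞 E) E)ˣ) : AdeleRing (𝓞 E) E) *
        conjAdele F E c (d 0 : AdeleRing (𝓞 E) E) = 1 := by
      rw [← map_mul, Units.inv_mul, map_one]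
    have h2 : conjAdele F E c (d 0 : AdeleRing (𝓞 E) E) = ((d 2)⁻¹ : (AdeleRing (𝓞 E) E)ˣ) :=
      (Units.inv_eq_of_mul_eq_one_left h02).symm
    rw [h2] at h1
    calc conjAdele F E c (((d 0)⁻¹ : (AdeleRing (𝓞 E) E)ˣ) : AdeleRing (𝓞 E) E)
        = conjAdele F E c (((d 0)⁻¹ : (AdeleRing (𝓞 E) E)ˣ) : AdeleRing (𝓞 E) E) *
            (((d 2)⁻¹ : (AdeleRing (𝓞 E) E)ˣ) : AdeleRing (𝓞 E) E) * d 2 := by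
          rw [mul_assoc, Units.inv_mul, mul_one]
      _ = d 2 := by rw [h1, one_mul]
  refine ⟨?_, ?_⟩
  · rw [Units.val_mul, map_mul, hc0, hc1, Units.val_mul, mul_comm]
  · simp only [Units.val_mul]
    calc (((d 0)⁻¹ : (AdeleRing (𝓞 E) E)ˣ) : AdeleRing (𝓞 E) E) * d 1 * ((((d 1)⁻¹ : (AdeleRing (𝓞 E) E)ˣ) : AdeleRing (𝓞 E) E) * d 2)
        = (((d 0)⁻¹ : (AdeleRing (𝓞 E) E)ˣ) : AdeleRing (𝓞 E) E) * ((d 1 : AdeleRing (𝓞 E) E) * (((d 1)⁻¹ : (AdeleRing (𝓞 E) E)ˣ) : AdeleRing (𝓞 E) E)) * d 2 := by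
          ring
      _ = (((d 0)⁻¹ : (AdeleRing (𝓞 E) E)ˣ) : AdeleRing (𝓞 E) E) * d 2 := by rw [Units.mul_inv, mul_one]

/-! ## §2 The identity for the first parameter -/

/-- **`y′ + ½ x′c(x′) = d₀⁻¹d₂ · (y + ½ x c(x)) + d₁⁻¹d₂ · (x₀ c(x)) − d₀⁻¹d₁ · (x c(x₀))`** for the coordinates `x′, y′` of `b⁻¹ub` (`x, y` those of `u`,
`x₀ = x(n₀)`). [cite: Rogawski1990, §2.2 (p. 13)] -/
theorem archParam_identity (hc : c * c = 1) (b : borelAdelic F E c 3) (u : adelicUnipotent F E c 3) :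
    ((coordY hc ⟨(b : (quasiSplit F E c 3).Adelic)⁻¹ * (u : (quasiSplit F E c 3).Adelic) * (b : (quasiSplit F E c 3).Adelic),
          borel_inv_mul_mul_mem_adelicUnipotent b u⟩ : traceZeroAdele F E c) : AdeleRing (𝓞 E) E) +
        halfAdele * (coordX ⟨(b : (quasiSplit F E c 3).Adelic)⁻¹ * (u : (quasiSplit F E c 3).Adelic) * (b : (quasiSplit F E c 3).Adelic),
            borel_inv_mul_mul_mem_adelicUnipotent b u⟩ *
          conjAdele F E c (coordX ⟨(b : (quasiSplit F E c 3).Adelic)⁻¹ * (u : (quasiSplit F E c 3).Adelic) * (b : (quasiSplit F E c 3).Adelic),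
            borel_inv_mul_mul_mem_adelicUnipotent b u⟩)) =
      ((((diagUnit b.2 0)⁻¹ * diagUnit b.2 2 : (AdeleRing (𝓞 E) E)ˣ)) : AdeleRing (𝓞 E) E) *
          (((coordY hc u : traceZeroAdele F E c) : AdeleRing (𝓞 E) E) + halfAdele * (coordX u * conjAdele F E c (coordX u))) +
        ((((diagUnit b.2 1)⁻¹ * diagUnit b.2 2 : (AdeleRing (𝓞 E) E)ˣ)) : AdeleRing (𝓞 E) E) *
          (coordX ⟨(((torusPart b)⁻¹ * b : borelAdelic F E c 3) : (quasiSplit F E c 3).Adelic), torusPart_inv_mul_mem_adelicUnipotent b⟩ *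
            conjAdele F E c (coordX u)) -
        ((((diagUnit b.2 0)⁻¹ * diagUnit b.2 1 : (AdeleRing (𝓞 E) E)ˣ)) : AdeleRing (𝓞 E) E) *
          (coordX u * conjAdele F E c (coordX ⟨(((torusPart b)⁻¹ * b : borelAdelic F E c 3) : (quasiSplit F E c 3).Adelic),
            torusPart_inv_mul_mem_adelicUnipotent b⟩)) := by
  obtain ⟨hcα, hαγ⟩ := conjAdele_rootOne_eq (F := F) (E := E) (c := c) b
  rw [coe_coordY_borel_conj hc b u, coordX_borel_conj b u, map_mul, hcα]
  linear_combination (halfAdele * (coordX u * conjAdele F E c (coordX u))) * hαγ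

/-! ## §3 The bound `‖aᵢ‖ ≤ C · ρ(d)` for `u` in a compact set and `n₀` in a compact set -/

/-- The archimedean reading `x ↦ x_∞ ∈ E ⊗ ℝ` (★ `archHom`) is continuous. [folklore] -/
private theorem continuous_archHom' : Continuous (archHom E) :=
  (continuous_ringEquiv_mixedSpace E).comp continuous_fst

/-- The chart coordinates `x(u)`, `y(u)` and `c(x(u))` are continuous on `N(𝔸_F)`. [folklore] -/
private theorem continuous_coords' (hc : c * c = 1) :
    Continuous (fun u : adelicUnipotent F E c 3 => coordX u) ∧
      Continuous (fun u : adelicUnipotent F E c 3 => ((coordY hc u : traceZeroAdele F E c) : AdeleRing (𝓞 E) E)) ∧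
      Continuous (fun u : adelicUnipotent F E c 3 => conjAdele F E c (coordX u)) := by
  have hX : Continuous (fun u : adelicUnipotent F E c 3 => coordX u) := continuous_heisX.comp continuous_unipToBorel
  exact ⟨hX, continuous_subtype_val.comp ((continuous_heisY hc).comp continuous_unipToBorel), (continuous_conjAdele F E c).comp hX⟩

/-- Normed-ring bookkeeping for the first parameter: `‖βP + γ(X₀·X̄) − α(X·X̄₀)‖ ≤ (K₁ + K_{x₀}K_{cX} + K_X K_{cx₀}) · ρ`. [folklore] -/
private theorem norm_first_param_le {A : Type*} [NonUnitalSeminormedRing A] {aα aβ aγ P X0 cX X cX0 : A}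
    {ρ K1 Kx0 KcX KX Kcx0 : ℝ} (hρ0 : 0 ≤ ρ) (hKx0 : 0 ≤ Kx0) (hKX : 0 ≤ KX)
    (hα : ‖aα‖ ≤ ρ) (hβ : ‖aβ‖ ≤ ρ) (hγ : ‖aγ‖ ≤ ρ) (hP : ‖P‖ ≤ K1) (hX0 : ‖X0‖ ≤ Kx0) (hcX : ‖cX‖ ≤ KcX)
    (hX : ‖X‖ ≤ KX) (hcX0 : ‖cX0‖ ≤ Kcx0) :
    ‖aβ * P + aγ * (X0 * cX) - aα * (X * cX0)‖ ≤ (K1 + Kx0 * KcX + KX * Kcx0) * ρ := by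
  calc ‖aβ * P + aγ * (X0 * cX) - aα * (X * cX0)‖
      ≤ ‖aβ * P‖ + ‖aγ * (X0 * cX)‖ + ‖aα * (X * cX0)‖ := (norm_sub_le _ _).trans (add_le_add (norm_add_le _ _) le_rfl)
    _ ≤ ρ * K1 + ρ * (Kx0 * KcX) + ρ * (KX * Kcx0) := by
        refine add_le_add (add_le_add ?_ ?_) ?_
        · exact (norm_mul_le _ _).trans (mul_le_mul hβ hP (norm_nonneg _) hρ0)
        · exact (norm_mul_le _ _).trans (mul_le_mul hγ ((norm_mul_le _ _).trans (mul_le_mul hX0 hcX (norm_nonneg _) hKx0)) (norm_nonneg _) hρ0)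
        · exact (norm_mul_le _ _).trans (mul_le_mul hα ((norm_mul_le _ _).trans (mul_le_mul hX hcX0 (norm_nonneg _) hKX)) (norm_nonneg _) hρ0)
    _ = (K1 + Kx0 * KcX + KX * Kcx0) * ρ := by ring

/-- Normed-ring bookkeeping for the other parameters: `‖a·X‖ ≤ K · ρ`. [folklore] -/
private theorem norm_mul_param_le {A : Type*} [NonUnitalSeminormedRing A] {a X : A} {ρ K : ℝ} (hρ0 : 0 ≤ ρ)
    (ha : ‖a‖ ≤ ρ) (hX : ‖X‖ ≤ K) : ‖a * X‖ ≤ K * ρ :=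
  (norm_mul_le _ _).trans ((mul_le_mul ha hX (norm_nonneg _) hρ0).trans_eq (mul_comm _ _))

/-- **THE ARCHIMEDEAN CONTRACTION.** For compact `K_N, Ω ⊆ N(𝔸_F)` there is `C ≥ 0` such that for every `b ∈ B(𝔸_F)` with unipotent part
`n₀ = (torusPart b)⁻¹ b ∈ Ω` and every `u ∈ K_N`, the three archimedean parameters of ★ `adelicVal_borel_mul_conj_eq_threeFactor` satisfy
`‖(y′ + ½ x′c(x′))_∞‖ ≤ C ρ(d)`, `‖x′_∞‖ ≤ C ρ(d)`, `‖(−c(x′))_∞‖ ≤ C ρ(d)`, where `ρ(d) = max (max ‖(d₀⁻¹d₁)_∞‖ ‖(d₀⁻¹d₂)_∞‖) ‖(d₁⁻¹d₂)_∞‖`, `d = diagUnit b`.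
[cite: Rogawski1990, §2.2 (p. 13)] -/
theorem exists_forall_norm_archParam_le (hc : c * c = 1) {KN Ω : Set (adelicUnipotent F E c 3)} (hKN : IsCompact KN) (hΩ : IsCompact Ω) :
    ∃ C : ℝ, 0 ≤ C ∧ ∀ b : borelAdelic F E c 3,
      (⟨(((torusPart b)⁻¹ * b : borelAdelic F E c 3) : (quasiSplit F E c 3).Adelic), torusPart_inv_mul_mem_adelicUnipotent b⟩ :
          adelicUnipotent F E c 3) ∈ Ω →
      ∀ u ∈ KN,
        ‖archHom E (((coordY hc ⟨(b : (quasiSplit F E c 3).Adelic)⁻¹ * (u : (quasiSplit F E c 3).Adelic) * (b : (quasiSplit F E c 3).Adelic),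
              borel_inv_mul_mul_mem_adelicUnipotent b u⟩ : traceZeroAdele F E c) : AdeleRing (𝓞 E) E) +
            halfAdele * (coordX ⟨(b : (quasiSplit F E c 3).Adelic)⁻¹ * (u : (quasiSplit F E c 3).Adelic) * (b : (quasiSplit F E c 3).Adelic),
                borel_inv_mul_mul_mem_adelicUnipotent b u⟩ *
              conjAdele F E c (coordX ⟨(b : (quasiSplit F E c 3).Adelic)⁻¹ * (u : (quasiSplit F E c 3).Adelic) * (b : (quasiSplit F E c 3).Adelic),
                borel_inv_mul_mul_mem_adelicUnipotent b u⟩)))‖ ≤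
            C * max (max ‖archHom E ((((diagUnit b.2 0)⁻¹ * diagUnit b.2 1 : (AdeleRing (𝓞 E) E)ˣ)) : AdeleRing (𝓞 E) E)‖
              ‖archHom E ((((diagUnit b.2 0)⁻¹ * diagUnit b.2 2 : (AdeleRing (𝓞 E) E)ˣ)) : AdeleRing (𝓞 E) E)‖)
              ‖archHom E ((((diagUnit b.2 1)⁻¹ * diagUnit b.2 2 : (AdeleRing (𝓞 E) E)ˣ)) : AdeleRing (𝓞 E) E)‖ ∧
        ‖archHom E (coordX ⟨(b : (quasiSplit F E c 3).Adelic)⁻¹ * (u : (quasiSplit F E c 3).Adelic) * (b : (quasiSplit F E c 3).Adelic),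
              borel_inv_mul_mul_mem_adelicUnipotent b u⟩)‖ ≤
            C * max (max ‖archHom E ((((diagUnit b.2 0)⁻¹ * diagUnit b.2 1 : (AdeleRing (𝓞 E) E)ˣ)) : AdeleRing (𝓞 E) E)‖
              ‖archHom E ((((diagUnit b.2 0)⁻¹ * diagUnit b.2 2 : (AdeleRing (𝓞 E) E)ˣ)) : AdeleRing (𝓞 E) E)‖)
              ‖archHom E ((((diagUnit b.2 1)⁻¹ * diagUnit b.2 2 : (AdeleRing (𝓞 E) E)ˣ)) : AdeleRing (𝓞 E) E)‖ ∧
        ‖archHom E (-conjAdele F E c (coordX ⟨(b : (quasiSplit F E c 3).Adelic)⁻¹ * (u : (quasiSplit F E c 3).Adelic) * (b : (quasiSplit F E c 3).Adelic),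
              borel_inv_mul_mul_mem_adelicUnipotent b u⟩))‖ ≤
            C * max (max ‖archHom E ((((diagUnit b.2 0)⁻¹ * diagUnit b.2 1 : (AdeleRing (𝓞 E) E)ˣ)) : AdeleRing (𝓞 E) E)‖
              ‖archHom E ((((diagUnit b.2 0)⁻¹ * diagUnit b.2 2 : (AdeleRing (𝓞 E) E)ˣ)) : AdeleRing (𝓞 E) E)‖)
              ‖archHom E ((((diagUnit b.2 1)⁻¹ * diagUnit b.2 2 : (AdeleRing (𝓞 E) E)ˣ)) : AdeleRing (𝓞 E) E)‖ := by
  obtain ⟨hX, hY, hcX⟩ := continuous_coords' (F := F) (E := E) (c := c) hc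
  have hA := continuous_archHom' (E := E)
  -- the five sup bounds
  obtain ⟨CX, hCX⟩ := hKN.exists_bound_of_continuousOn (f := fun u : adelicUnipotent F E c 3 => archHom E (coordX u)) (hA.comp hX).continuousOn
  obtain ⟨CcX, hCcX⟩ := hKN.exists_bound_of_continuousOn (f := fun u : adelicUnipotent F E c 3 => archHom E (conjAdele F E c (coordX u)))
    (hA.comp hcX).continuousOn
  obtain ⟨CY, hCY⟩ := hKN.exists_bound_of_continuousOn
    (f := fun u : adelicUnipotent F E c 3 => archHom E ((coordY hc u : traceZeroAdele F E c) : AdeleRing (𝓞 E) E)) (hA.comp hY).continuousOn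
  obtain ⟨Cx0, hCx0⟩ := hΩ.exists_bound_of_continuousOn (f := fun n : adelicUnipotent F E c 3 => archHom E (coordX n)) (hA.comp hX).continuousOn
  obtain ⟨Ccx0, hCcx0⟩ := hΩ.exists_bound_of_continuousOn (f := fun n : adelicUnipotent F E c 3 => archHom E (conjAdele F E c (coordX n)))
    (hA.comp hcX).continuousOn
  refine ⟨max (max (max CX 0) (max CcX 0)) ((max CY 0 + ‖archHom E (halfAdele : AdeleRing (𝓞 E) E)‖ * (max CX 0 * max CcX 0)) + max Cx0 0 * max CcX 0 + max CX 0 * max Ccx0 0),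
    le_max_of_le_left (le_max_of_le_left (le_max_right _ _)), ?_⟩
  intro b hn₀ u hu
  have hρα : ‖archHom E ((((diagUnit b.2 0)⁻¹ * diagUnit b.2 1 : (AdeleRing (𝓞 E) E)ˣ)) : AdeleRing (𝓞 E) E)‖ ≤ max (max ‖archHom E ((((diagUnit b.2 0)⁻¹ * diagUnit b.2 1 : (AdeleRing (𝓞 E) E)ˣ)) : AdeleRing (𝓞 E) E)‖ ‖archHom E ((((diagUnit b.2 0)⁻¹ * diagUnit b.2 2 : (AdeleRing (𝓞 E) E)ˣ)) : AdeleRing (𝓞 E) E)‖) ‖archHom E ((((diagUnit b.2 1)⁻¹ * diagUnit b.2 2 : (AdeleRing (𝓞 E) E)ˣ)) : AdeleRing (𝓞 E) E)‖ := le_max_of_le_left (le_max_left _ _)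
  have hρβ : ‖archHom E ((((diagUnit b.2 0)⁻¹ * diagUnit b.2 2 : (AdeleRing (𝓞 E) E)ˣ)) : AdeleRing (𝓞 E) E)‖ ≤ max (max ‖archHom E ((((diagUnit b.2 0)⁻¹ * diagUnit b.2 1 : (AdeleRing (𝓞 E) E)ˣ)) : AdeleRing (𝓞 E) E)‖ ‖archHom E ((((diagUnit b.2 0)⁻¹ * diagUnit b.2 2 : (AdeleRing (𝓞 E) E)ˣ)) : AdeleRing (𝓞 E) E)‖) ‖archHom E ((((diagUnit b.2 1)⁻¹ * diagUnit b.2 2 : (AdeleRing (𝓞 E) E)ˣ)) : AdeleRing (𝓞 E) E)‖ := le_max_of_le_left (le_max_right _ _)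
  have hργ : ‖archHom E ((((diagUnit b.2 1)⁻¹ * diagUnit b.2 2 : (AdeleRing (𝓞 E) E)ˣ)) : AdeleRing (𝓞 E) E)‖ ≤ max (max ‖archHom E ((((diagUnit b.2 0)⁻¹ * diagUnit b.2 1 : (AdeleRing (𝓞 E) E)ˣ)) : AdeleRing (𝓞 E) E)‖ ‖archHom E ((((diagUnit b.2 0)⁻¹ * diagUnit b.2 2 : (AdeleRing (𝓞 E) E)ˣ)) : AdeleRing (𝓞 E) E)‖) ‖archHom E ((((diagUnit b.2 1)⁻¹ * diagUnit b.2 2 : (AdeleRing (𝓞 E) E)ˣ)) : AdeleRing (𝓞 E) E)‖ := le_max_right _ _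
  have hρ0 : 0 ≤ max (max ‖archHom E ((((diagUnit b.2 0)⁻¹ * diagUnit b.2 1 : (AdeleRing (𝓞 E) E)ˣ)) : AdeleRing (𝓞 E) E)‖ ‖archHom E ((((diagUnit b.2 0)⁻¹ * diagUnit b.2 2 : (AdeleRing (𝓞 E) E)ˣ)) : AdeleRing (𝓞 E) E)‖) ‖archHom E ((((diagUnit b.2 1)⁻¹ * diagUnit b.2 2 : (AdeleRing (𝓞 E) E)ˣ)) : AdeleRing (𝓞 E) E)‖ := (norm_nonneg _).trans hρα
  -- the bounds at `u` and `n₀`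
  have bX : ‖archHom E (coordX u)‖ ≤ max CX 0 := (hCX u hu).trans (le_max_left _ _)
  have bcX : ‖archHom E (conjAdele F E c (coordX u))‖ ≤ max CcX 0 := (hCcX u hu).trans (le_max_left _ _)
  have bY : ‖archHom E ((coordY hc u : traceZeroAdele F E c) : AdeleRing (𝓞 E) E)‖ ≤ max CY 0 := (hCY u hu).trans (le_max_left _ _)
  have b1 : ‖archHom E (((coordY hc u : traceZeroAdele F E c) : AdeleRing (𝓞 E) E) + halfAdele * (coordX u * conjAdele F E c (coordX u)))‖ ≤
      max CY 0 + ‖archHom E (halfAdele : AdeleRing (𝓞 E) E)‖ * (max CX 0 * max CcX 0) := by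
    rw [map_add, map_mul, map_mul]
    exact (norm_add_le _ _).trans (add_le_add bY ((norm_mul_le _ _).trans
      (mul_le_mul_of_nonneg_left ((norm_mul_le _ _).trans (mul_le_mul bX bcX (norm_nonneg _) (le_max_right _ _))) (norm_nonneg _))))
  have bx0 : ‖archHom E (coordX (⟨(((torusPart b)⁻¹ * b : borelAdelic F E c 3) : (quasiSplit F E c 3).Adelic), torusPart_inv_mul_mem_adelicUnipotent b⟩ :
          adelicUnipotent F E c 3))‖ ≤ max Cx0 0 := (hCx0 _ hn₀).trans (le_max_left _ _)
  have bcx0 : ‖archHom E (conjAdele F E c (coordX (⟨(((torusPart b)⁻¹ * b : borelAdelic F E c 3) : (quasiSplit F E c 3).Adelic), torusPart_inv_mul_mem_adelicUnipotent b⟩ :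
          adelicUnipotent F E c 3)))‖ ≤ max Ccx0 0 := (hCcx0 _ hn₀).trans (le_max_left _ _)
  have hCle1 : max CX 0 ≤ max (max (max CX 0) (max CcX 0)) ((max CY 0 + ‖archHom E (halfAdele : AdeleRing (𝓞 E) E)‖ * (max CX 0 * max CcX 0)) + max Cx0 0 * max CcX 0 + max CX 0 * max Ccx0 0) :=
    le_max_of_le_left (le_max_left _ _)
  have hCle2 : max CcX 0 ≤ max (max (max CX 0) (max CcX 0)) ((max CY 0 + ‖archHom E (halfAdele : AdeleRing (𝓞 E) E)‖ * (max CX 0 * max CcX 0)) + max Cx0 0 * max CcX 0 + max CX 0 * max Ccx0 0) :=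
    le_max_of_le_left (le_max_right _ _)
  have hCle3 : (max CY 0 + ‖archHom E (halfAdele : AdeleRing (𝓞 E) E)‖ * (max CX 0 * max CcX 0)) + max Cx0 0 * max CcX 0 + max CX 0 * max Ccx0 0 ≤
      max (max (max CX 0) (max CcX 0)) ((max CY 0 + ‖archHom E (halfAdele : AdeleRing (𝓞 E) E)‖ * (max CX 0 * max CcX 0)) + max Cx0 0 * max CcX 0 + max CX 0 * max Ccx0 0) := le_max_right _ _
  -- coordinates of `b⁻¹ u b`
  have hx : coordX ⟨(b : (quasiSplit F E c 3).Adelic)⁻¹ * (u : (quasiSplit F E c 3).Adelic) * (b : (quasiSplit F E c 3).Adelic),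
      borel_inv_mul_mul_mem_adelicUnipotent b u⟩ = ((((diagUnit b.2 0)⁻¹ * diagUnit b.2 1 : (AdeleRing (𝓞 E) E)ˣ)) : AdeleRing (𝓞 E) E) * coordX u := coordX_borel_conj b u
  obtain ⟨hcα, -⟩ := conjAdele_rootOne_eq (F := F) (E := E) (c := c) b
  refine ⟨?_, ?_, ?_⟩
  · rw [archParam_identity hc b u, map_sub, map_add, map_mul, map_mul, map_mul, map_mul, map_mul]
    exact (norm_first_param_le hρ0 (le_max_right _ _) (le_max_right _ _) hρα hρβ hργ b1 bx0 bcX bX bcx0).trans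
      (mul_le_mul_of_nonneg_right hCle3 hρ0)
  · rw [hx, map_mul]
    exact (norm_mul_param_le hρ0 hρα bX).trans (mul_le_mul_of_nonneg_right hCle1 hρ0)
  · rw [hx, map_neg, norm_neg, map_mul, hcα, map_mul]
    exact (norm_mul_param_le hρ0 hργ bcX).trans (mul_le_mul_of_nonneg_right hCle2 hρ0)

end UnitaryGroup

end Literature.NumberTheory.Automorphic

end
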